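import Summits.BirchSwinnertonDyer.BirchSwinnertonDyer.Theorems.ByReductionTypeAtTwoAdditiveKatoFineDivisionFieldFourI
import Summits.BirchSwinnertonDyer.BirchSwinnertonDyer.Theorems.AlignedTransportAtTwoMainConjectureOfRankZeroBSDAtTwoTorsionPointField
import HarnessLib

/-!
# Route `ByReductionTypeAtTwo` (rung K4), crux `AdditiveRankZeroAtTwo` (item stmt-BirchSwinnertonDyer-19098),
# line add_twist_overK v2, stub `stub_addDefectUpper` (hU3): the honest Lim@2 carrier `ℚ(P, √−1)` — the `2`-torsion
# point field with `√−1` adjoined — lies in `ℚ(E[4])` with `2`-power index, for EVERY curve and every non-zero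
# `P ∈ E[2]` (a `--supports` file; seat `bsd-2adic-addL2x` GEN 9; sequel of `…KatoFineDivisionFieldFourI.lean`)

HONEST FRAMING (cell `bsd-2adic`, HUMAN RULING D-0036/D-0054): types-the-object-of; closes none at the ∀-level; nothing
booked; BSD is not proved by any of this. §1 PROVED outright; §2 CONDITIONAL only on the PRINT facts named (`hLim2`, `hFuk`).

WHY. GEN 8's census certified Coates–Sujatha's (A) at `(E,2)` on 160 `Δ_E > 0` classes of the block with a Fukuda class-group
certificate on the CUBIC POINT FIELD WITH `i` ADJOINED, `F₃(i) = ℚ(P, i)` (degree `6` when `E[2]` is irreducible) — the honest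
totally imaginary witness of the Lim@2 scope rider — displaying `L`, `L ≤ ℚ(E[4])` and the `2`-power index as hypotheses. The
cell bsd-f1-sign2 (`…AlignedTransportAtTwo…TorsionPointField.lean`) PROVED both carrier hypotheses for the REAL point field
`ℚ(P) = ℚ̄^{Stab(P)}` (`fixedField_stabilizer_le_divisionField_four`,
`exists_finrank_divisionField_four_eq_pow_mul_finrank_fixedField_stabilizer`); GEN 9's `…DivisionFieldFourI.lean` put `√−1`
inside `ℚ(E[4])`. This file combines the two: for every elliptic `W/ℚ`, every `P ∈ E[2] ∖ 0` and every `i² = −1`,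
`ℚ(P) ⊔ ℚ⟮i⟯ ≤ ℚ(E[4])` and `[ℚ(E[4]) : ℚ] = 2^j·[ℚ(P, i) : ℚ]` — the index because `[ℚ(E[4]) : ℚ(P, i)]` divides
`[ℚ(E[4]) : ℚ(P)] = 2^k` (Mathlib `relfinrank`; no degree computation for `ℚ(P, i)/ℚ(P)` is needed).

* §1 `exists_finrank_divisionField_four_eq_pow_mul_of_le_of_pow_mul` — any `A ≤ L ≤ ℚ(E[4])` with `[ℚ(E[4]):ℚ] = 2^k·[A:ℚ]`
  has `[ℚ(E[4]):ℚ] = 2^j·[L:ℚ]`; `pointField_sup_adjoin_le_divisionField_four`, `exists_finrank_divisionField_four_eq_pow_mul_pointField_sup_adjoin`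
  — the two carrier hypotheses for `ℚ(P, i)`.
* §2 doors `conjA_two_of_classicalMu_pointField_adjoin_I` ((A)`(W,2)` ⟸ `μ₂ = 0` along the cyclotomic `ℤ₂`-towers of `ℚ(P, i)`,
  `hLim2` BY NAME) and `conjA_two_of_fukudaCertificate_pointField_adjoin_I` (⟸ a Fukuda certificate on `ℚ(P, i)`, `hLim2` + `hFuk`
  BY NAME) — GEN 8's certificate road «F₃(i)» with only the class-group certificate left displayed.

References: [Lim2017FineSelmer] §3 Thm. 3.5; [Fukuda1994] Thm. 1 (2); [Serre1972] §IV; [CoatesSujatha2005] statement (A).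
Memo: `run/shared/lean/pub/bsd-2adic/addL2x/VERDICT-19098-addL2x-GEN9.md`.
-/

set_option autoImplicit false
-- sibling precedent (`ByReductionTypeAtTwoAdditiveKatoFineDivisionFieldFourI.lean`): the directory name repeats the summit name
set_option linter.dupNamespace false

noncomputable section

open scoped Classical

namespace Summit.BirchSwinnertonDyer.BirchSwinnertonDyer.Theorems.AddKatoTwo

open WeierstrassCurve Field Literature.NumberTheory.EllipticCurves
  Literature.NumberTheory.EllipticCurves.Rank1Residual
  Literature.NumberTheory.EllipticCurves.Rank1Residual.Typed
  Literature.NumberTheory.IwasawaTheory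
  Summit.BirchSwinnertonDyer.Rank1Residual.X5.AddTwoL2
  Summit.BirchSwinnertonDyer.BirchSwinnertonDyer.Theorems.AlignedTransportAtTwoTorsionPointField

/-! ## §1 The carrier `ℚ(P, i)` -/

/-- **`2`-power index is inherited upwards below `ℚ(E[4])`**: if `A ≤ L ≤ ℚ(E[4])` and `[ℚ(E[4]) : ℚ] = 2^k·[A : ℚ]`, then
`[ℚ(E[4]) : ℚ] = 2^j·[L : ℚ]` (`[ℚ(E[4]) : L]` divides `[ℚ(E[4]) : A] = 2^k`; Mathlib `relfinrank`). [folklore] -/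
theorem exists_finrank_divisionField_four_eq_pow_mul_of_le_of_pow_mul (W : WeierstrassCurve ℚ) [W.IsElliptic]
    {A L : IntermediateField ℚ (AlgebraicClosure ℚ)} [FiniteDimensional ℚ A] (hAL : A ≤ L) (hL4 : L ≤ W.divisionField 4)
    {k : ℕ} (hk : Module.finrank ℚ (W.divisionField 4) = 2 ^ k * Module.finrank ℚ A) :
    ∃ j : ℕ, Module.finrank ℚ (W.divisionField 4) = 2 ^ j * Module.finrank ℚ L := by
  have hA4 : A ≤ W.divisionField 4 := hAL.trans hL4
  have hpos : 0 < Module.finrank ℚ A := Module.finrank_pos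
  have h1 := IntermediateField.finrank_bot_mul_relfinrank hA4
  have hrel : IntermediateField.relfinrank A (W.divisionField 4) = 2 ^ k := by
    apply Nat.eq_of_mul_eq_mul_left hpos
    rw [h1, mul_comm]
    exact hk
  have hdvd : IntermediateField.relfinrank L (W.divisionField 4) ∣ 2 ^ k :=
    hrel ▸ IntermediateField.relfinrank_dvd_of_le_left (C := W.divisionField 4) hAL
  obtain ⟨j, -, hj⟩ := (Nat.dvd_prime_pow Nat.prime_two).mp hdvd
  refine ⟨j, ?_⟩
  have h2 := IntermediateField.finrank_bot_mul_relfinrank hL4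
  rw [hj, mul_comm] at h2
  exact h2.symm

/-- **`ℚ(P, i) ≤ ℚ(E[4])`** for every `P ∈ E[2]` and `i² = −1` (`ℚ(P) ≤ ℚ(E[4])` by bsd-f1-sign2's
`fixedField_stabilizer_le_divisionField_four`; `i ∈ ℚ(E[4])` by `mem_divisionField_four_of_sq_eq_neg_one`).
[cite: Lim2017FineSelmer, §3 Thm. 3.5 (hypothesis L ⊆ F(E[4]))] [cite: Serre1972, §IV] -/
theorem pointField_sup_adjoin_le_divisionField_four (W : WeierstrassCurve ℚ) [W.IsElliptic] (P : geomTorsion W 2)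
    {i : AlgebraicClosure ℚ} (hi : i ^ 2 = -1) :
    IntermediateField.fixedField (MulAction.stabilizer (absoluteGaloisGroup ℚ) P) ⊔ IntermediateField.adjoin ℚ {i} ≤
      W.divisionField 4 := by
  refine sup_le (fixedField_stabilizer_le_divisionField_four W P) ?_
  rw [IntermediateField.adjoin_le_iff, Set.singleton_subset_iff]
  exact mem_divisionField_four_of_sq_eq_neg_one W two_ne_zero hi

/-- **`[ℚ(E[4]) : ℚ] = 2^j · [ℚ(P, i) : ℚ]`** for every NON-ZERO `P ∈ E[2]` and `i² = −1` (from bsd-f1-sign2's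
`[ℚ(E[4]) : ℚ] = 2^k·[ℚ(P) : ℚ]` and §1's upward inheritance). [cite: Lim2017FineSelmer, §3 Thm. 3.5 (hypothesis on L)]
[cite: Serre1972, §IV] -/
theorem exists_finrank_divisionField_four_eq_pow_mul_pointField_sup_adjoin (W : WeierstrassCurve ℚ) [W.IsElliptic]
    {P : geomTorsion W 2} (hP : P ≠ 0) {i : AlgebraicClosure ℚ} (hi : i ^ 2 = -1) :
    ∃ j : ℕ, Module.finrank ℚ (W.divisionField 4) = 2 ^ j * Module.finrank ℚ
      ↥(IntermediateField.fixedField (MulAction.stabilizer (absoluteGaloisGroup ℚ) P) ⊔ IntermediateField.adjoin ℚ {i}) := by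
  haveI := finiteDimensional_fixedField_stabilizer W P
  obtain ⟨k, hk⟩ := exists_finrank_divisionField_four_eq_pow_mul_finrank_fixedField_stabilizer W hP
  exact exists_finrank_divisionField_four_eq_pow_mul_of_le_of_pow_mul W le_sup_left
    (pointField_sup_adjoin_le_divisionField_four W P hi) hk

/-! ## §2 Doors on the carrier `ℚ(P, i)` -/

/-- **Statement (A) at `(W, 2)` from Iwasawa's classical `μ₂ = 0` for `ℚ(P, i)`** (any elliptic `W/ℚ`, any non-zero
`P ∈ E[2]`, `i² = −1`; `hLim2` BY NAME; both carrier hypotheses DISCHARGED). For irreducible `E[2]` this is the cubic point field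
with `i` adjoined, `F₃(i)` — totally imaginary, the honest witness of the Lim@2 scope rider for either sign of `Δ_E`.
[cite: Lim2017FineSelmer, §3 Thm. 3.5 and Lemma 3.2] [cite: CoatesSujatha2005, statement (A) and Thm. 3.4] -/
theorem conjA_two_of_classicalMu_pointField_adjoin_I
    (hLim2 : Lim2017.thm35_at_two_fineSelmerDual_moduleFinite_of_classicalMuVanishes_of_le_divisionField_four)
    (W : WeierstrassCurve ℚ) [W.IsElliptic] {P : geomTorsion W 2} (hP : P ≠ 0) {i : AlgebraicClosure ℚ} (hi : i ^ 2 = -1)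
    (hμ : ∀ κL : ZpExtension
        ↥(IntermediateField.fixedField (MulAction.stabilizer (absoluteGaloisGroup ℚ) P) ⊔ IntermediateField.adjoin ℚ {i}) 2,
      κL.IsCyclotomic → ClassicalMuVanishes κL) :
    ∀ (κ : ZpExtension ℚ 2), κ.IsCyclotomic →
      ∃ (γ : Field.absoluteGaloisGroup ℚ) (D : W.FineSelmerDualData κ γ),
        Module.Finite ℤ_[2] (RestrictScalars ℤ_[2] (IwasawaAlgebra 2) D.X) :=
  hLim2 W _ (pointField_sup_adjoin_le_divisionField_four W P hi)
    (exists_finrank_divisionField_four_eq_pow_mul_pointField_sup_adjoin W hP hi) hμ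

/-- **Statement (A) at `(W, 2)` from a Fukuda class-group certificate on `ℚ(P, i)`** (any elliptic `W/ℚ`, `P ∈ E[2] ∖ 0`,
`i² = −1`; `hLim2` + `hFuk` BY NAME): total ramification of every cyclotomic `ℤ₂`-tower of `ℚ(P, i)` from layer `n₀` and equal
`2`-ranks of the class groups at layers `n₀`, `n₀ + 1` (the displayed certificate `hcert` — GEN 8's kit base «F₃(i)», degrees
`6·2^{n₀}`/`12·2^{n₀}` for irreducible `E[2]`) ⇒ (A)`(W,2)`. GEN 8's `conjA_two_of_fukudaCertificate` with `L`, `hL`, `hdeg` supplied.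
[cite: Fukuda1994, Thm. 1 (2), p. 264] [cite: Lim2017FineSelmer, §3 Thm. 3.5 and Lemma 3.2] [cite: CoatesSujatha2005, statement (A)] -/
theorem conjA_two_of_fukudaCertificate_pointField_adjoin_I
    (hLim2 : Lim2017.thm35_at_two_fineSelmerDual_moduleFinite_of_classicalMuVanishes_of_le_divisionField_four)
    (hFuk : fukuda1994_thm1_classGroupPRank_const_of_succ_eq)
    (W : WeierstrassCurve ℚ) [W.IsElliptic] {P : geomTorsion W 2} (hP : P ≠ 0) {i : AlgebraicClosure ℚ} (hi : i ^ 2 = -1)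
    (n₀ : ℕ)
    (hcert : ∀ κL : ZpExtension
        ↥(IntermediateField.fixedField (MulAction.stabilizer (absoluteGaloisGroup ℚ) P) ⊔ IntermediateField.adjoin ℚ {i}) 2,
      κL.IsCyclotomic → TotallyRamifiedFrom κL n₀ ∧ classGroupPRank κL (n₀ + 1) = classGroupPRank κL n₀) :
    ∀ (κ : ZpExtension ℚ 2), κ.IsCyclotomic →
      ∃ (γ : Field.absoluteGaloisGroup ℚ) (D : W.FineSelmerDualData κ γ),
        Module.Finite ℤ_[2] (RestrictScalars ℤ_[2] (IwasawaAlgebra 2) D.X) :=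
  conjA_two_of_fukudaCertificate hLim2 hFuk W _ (pointField_sup_adjoin_le_divisionField_four W P hi)
    (exists_finrank_divisionField_four_eq_pow_mul_pointField_sup_adjoin W hP hi) n₀ hcert

end Summit.BirchSwinnertonDyer.BirchSwinnertonDyer.Theorems.AddKatoTwo

end
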